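import Literature.NumberTheory.Automorphic.GLnPlacesSplittingCentralizer
import Literature.MeasureTheory.Group.InvariantQuotientOrbitalPiProdNormalized
import HarnessLib

/-!
# Gelbart's (10.19) for `GL_n` over `S` with its equality sign (quotients of product Haar measures)
(Gelbart, *Automorphic forms on adele groups* (1975), §10, p. 155, (10.19))

Topic `NumberTheory/Automorphic`; theorems only (no definition, no named fact, no instance visible
to importers). `GLnPlacesSplittingCentralizer` factors the orbital integrals of
`Φ = (⊗_{v ∈ S} ξ_v) ⊗ Θ` along `GLn.placesSplitting n K S : G_S × G^S ≃ₜ* GL_n(𝔸_K)` for arbitrary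
invariant measures up to ONE constant `c ≠ 0`. For the canonical quotient measures
`ν/ρ = quotientMeasure` of Haar measures that are products along the splitting — `ν = s_*((⨂_v ν_v) ⊗ ν^S)`
on `GL_n(𝔸_K)` and `ρ = s_*((⨂_v ρ_v) ⊗ ρ^S)` on the torus `B_𝔸 = C(γ) = s((Π_v B_v) × B^S)` (the
measures on the intermediate subgroups and the correspondences are hypotheses, as in the abstract
`InvariantQuotientOrbitalPiProdNormalized`) — the constant is `1`, which is (10.19) as printed:

* `GLn.lintegral_descConj_quotientMeasure_eq_prod_mul` (`[0, ∞]`-valued, measurable data: the shape of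
  the orbital integrals `∫⁻ descConj (toAdelic γ) C(γ) F d(quotientMeasure C(γ) ν_C ν)` in the class-term
  comparison `quaternion_glTwo_classTerm_eq`);
* `GLn.integral_descConj_quotientMeasure_eq_prod_mul` (complex-valued).

Part of the inline (D-0026) decomposition of
`Literature.NumberTheory.Automorphic.strong_multiplicity_one_quaternionUnits`.

## References

* S. Gelbart, *Automorphic forms on adele groups*, Ann. of Math. Studies 83 (1975), §10, p. 155,
  (10.19) [Gelbart1975].
-/

noncomputable section

open MeasureTheory MeasureTheory.Measure NumberField IsDedekindDomain
open scoped NNReal ENNReal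

namespace Literature.NumberTheory.Automorphic

open Literature.MeasureTheory.Group

section OrbitalNormalized

variable {n : ℕ} {K : Type} [Field K] [NumberField K] {S : Finset (HeightOneSpectrum (𝓞 K))}

attribute [local instance] adelicBorel borelSpace_adelic locallyCompactSpace_adelic
  secondCountableTopology_gl_adelic

/-- `GL_n(K_v)` is Hausdorff (it embeds continuously into the Hausdorff `GL_n(𝔸_K)`). [folklore] -/
theorem GLn.t2Space_local (v : HeightOneSpectrum (𝓞 K)) : T2Space (GL (Fin n) (v.adicCompletion K)) := by
  haveI : T2Space (AdelicGroupData.gl n K).Adelic := t2Space_gl n K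
  exact T2Space.of_injective_continuous (f := GLn.toAdelic n K v) (GLn.toAdelic_injective) (GLn.continuous_toAdelic n K v)

variable (n K S) in
/-- `G^S` is locally compact (a closed subgroup of `GL_n(𝔸_K)`). [folklore] -/
theorem GLn.locallyCompactSpace_trivialAt : LocallyCompactSpace (GLn.trivialAt n K S) := by
  haveI : ∀ v : HeightOneSpectrum (𝓞 K), T2Space (GL (Fin n) (v.adicCompletion K)) := fun v => GLn.t2Space_local v
  exact (GLn.isClosed_trivialAt n K S).isClosedEmbedding_subtypeVal.locallyCompactSpace

attribute [local instance] GLn.locallyCompactSpace_trivialAt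

variable [T2Space (AdelicGroupData.gl n K).Adelic]
    [∀ v : HeightOneSpectrum (𝓞 K), MeasurableSpace (GL (Fin n) (v.adicCompletion K))]
    [∀ v : HeightOneSpectrum (𝓞 K), BorelSpace (GL (Fin n) (v.adicCompletion K))]
    [∀ v : HeightOneSpectrum (𝓞 K), SecondCountableTopology (GL (Fin n) (v.adicCompletion K))]
    [∀ v : HeightOneSpectrum (𝓞 K), LocallyCompactSpace (GL (Fin n) (v.adicCompletion K))]
    (γ : (AdelicGroupData.gl n K).Adelic)
    (hC : IsClosed ((Subgroup.centralizer ({γ} : Set (AdelicGroupData.gl n K).Adelic) :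
      Subgroup (AdelicGroupData.gl n K).Adelic) : Set (AdelicGroupData.gl n K).Adelic))
    (hCv : ∀ v : S, IsClosed ((Subgroup.centralizer ({GLn.toLocalAt n K (v : HeightOneSpectrum (𝓞 K)) γ} :
      Set (GL (Fin n) ((v : HeightOneSpectrum (𝓞 K)).adicCompletion K))) :
        Set (GL (Fin n) ((v : HeightOneSpectrum (𝓞 K)).adicCompletion K)))))
    (hC' : IsClosed ((Subgroup.centralizer ({((GLn.placesSplitting n K S).symm γ).2} :
      Set (GLn.trivialAt n K S))) : Set (GLn.trivialAt n K S)))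
    [MeasurableSpace ((AdelicGroupData.gl n K).Adelic ⧸
      Subgroup.centralizer ({γ} : Set (AdelicGroupData.gl n K).Adelic))]
    [BorelSpace ((AdelicGroupData.gl n K).Adelic ⧸
      Subgroup.centralizer ({γ} : Set (AdelicGroupData.gl n K).Adelic))]
    [∀ v : S, MeasurableSpace (GL (Fin n) ((v : HeightOneSpectrum (𝓞 K)).adicCompletion K) ⧸
      Subgroup.centralizer ({GLn.toLocalAt n K (v : HeightOneSpectrum (𝓞 K)) γ} :
        Set (GL (Fin n) ((v : HeightOneSpectrum (𝓞 K)).adicCompletion K))))]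
    [∀ v : S, BorelSpace (GL (Fin n) ((v : HeightOneSpectrum (𝓞 K)).adicCompletion K) ⧸
      Subgroup.centralizer ({GLn.toLocalAt n K (v : HeightOneSpectrum (𝓞 K)) γ} :
        Set (GL (Fin n) ((v : HeightOneSpectrum (𝓞 K)).adicCompletion K))))]
    [MeasurableSpace (GLn.trivialAt n K S ⧸
      Subgroup.centralizer ({((GLn.placesSplitting n K S).symm γ).2} : Set (GLn.trivialAt n K S)))]
    [BorelSpace (GLn.trivialAt n K S ⧸
      Subgroup.centralizer ({((GLn.placesSplitting n K S).symm γ).2} : Set (GLn.trivialAt n K S)))]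
    -- Haar measures on the local tori `B_v` (`v ∈ S`) and on `B^S`
    (ρv : ∀ v : S, Measure (Subgroup.centralizer ({GLn.toLocalAt n K (v : HeightOneSpectrum (𝓞 K)) γ} :
        Set (GL (Fin n) ((v : HeightOneSpectrum (𝓞 K)).adicCompletion K)))))
    [∀ v, (ρv v).IsMulLeftInvariant] [∀ v, IsFiniteMeasureOnCompacts (ρv v)] [∀ v, (ρv v).IsOpenPosMeasure]
    [∀ v, (ρv v).IsInvInvariant] [∀ v, SigmaFinite (ρv v)]
    (ρ' : Measure (Subgroup.centralizer ({((GLn.placesSplitting n K S).symm γ).2} : Set (GLn.trivialAt n K S))))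
    [ρ'.IsMulLeftInvariant] [IsFiniteMeasureOnCompacts ρ'] [ρ'.IsOpenPosMeasure] [ρ'.IsInvInvariant] [SFinite ρ']
    -- the product Haar measures on `Π_v B_v ≤ G_S`, on `B_S = C(γ_S) ≤ G_S`, on `B_S × B^S`, and on `B_𝔸`
    (ρp : Measure (Subgroup.pi Set.univ fun v : S =>
      Subgroup.centralizer ({GLn.toLocalAt n K (v : HeightOneSpectrum (𝓞 K)) γ} :
        Set (GL (Fin n) ((v : HeightOneSpectrum (𝓞 K)).adicCompletion K)))))
    [ρp.IsMulLeftInvariant] [IsFiniteMeasureOnCompacts ρp] [ρp.IsOpenPosMeasure] [ρp.IsInvInvariant] [SFinite ρp]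
    (hρp : Measure.map (subgroupPiCoords fun v : S =>
      Subgroup.centralizer ({GLn.toLocalAt n K (v : HeightOneSpectrum (𝓞 K)) γ} :
        Set (GL (Fin n) ((v : HeightOneSpectrum (𝓞 K)).adicCompletion K)))) ρp = Measure.pi ρv)
    (ρ₁ : Measure (Subgroup.centralizer ({fun v : S => GLn.toLocalAt n K (v : HeightOneSpectrum (𝓞 K)) γ} :
      Set (GLn.LocalPi n K S))))
    [ρ₁.IsMulLeftInvariant] [IsFiniteMeasureOnCompacts ρ₁] [ρ₁.IsOpenPosMeasure] [ρ₁.IsInvInvariant] [SFinite ρ₁]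
    (hρ₁ : ρ₁ = Measure.map (subgroupCongrHomeomorph (MulEquiv.refl (GLn.LocalPi n K S))
      (Subgroup.pi Set.univ fun v : S =>
        Subgroup.centralizer ({GLn.toLocalAt n K (v : HeightOneSpectrum (𝓞 K)) γ} :
          Set (GL (Fin n) ((v : HeightOneSpectrum (𝓞 K)).adicCompletion K))))
      (Subgroup.centralizer ({fun v : S => GLn.toLocalAt n K (v : HeightOneSpectrum (𝓞 K)) γ} : Set (GLn.LocalPi n K S)))
      (fun p => by rw [MulEquiv.refl_apply, centralizer_singleton_pi_eq]) continuous_id continuous_id) ρp)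
    (ρq : Measure ((Subgroup.centralizer ({fun v : S => GLn.toLocalAt n K (v : HeightOneSpectrum (𝓞 K)) γ} :
        Set (GLn.LocalPi n K S))).prod
      (Subgroup.centralizer ({((GLn.placesSplitting n K S).symm γ).2} : Set (GLn.trivialAt n K S)))))
    [ρq.IsMulLeftInvariant] [IsFiniteMeasureOnCompacts ρq] [ρq.IsOpenPosMeasure] [ρq.IsInvInvariant] [SFinite ρq]
    (hρq : Measure.map (Subgroup.prodEquiv
      (Subgroup.centralizer ({fun v : S => GLn.toLocalAt n K (v : HeightOneSpectrum (𝓞 K)) γ} : Set (GLn.LocalPi n K S)))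
      (Subgroup.centralizer ({((GLn.placesSplitting n K S).symm γ).2} : Set (GLn.trivialAt n K S)))) ρq = ρ₁.prod ρ')
    (ρ : Measure (Subgroup.centralizer ({γ} : Set (AdelicGroupData.gl n K).Adelic)))
    [ρ.IsMulLeftInvariant] [IsFiniteMeasureOnCompacts ρ] [ρ.IsOpenPosMeasure] [ρ.IsInvInvariant] [SFinite ρ]
    (hρ : ρ = Measure.map (subgroupCongrHomeomorph (GLn.placesSplitting n K S).toMulEquiv _
      (Subgroup.centralizer ({γ} : Set (AdelicGroupData.gl n K).Adelic))
      (forall_apply_mem_centralizer_iff (GLn.placesSplitting n K S).toMulEquiv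
        (γ₁ := fun v : S => GLn.toLocalAt n K (v : HeightOneSpectrum (𝓞 K)) γ) (γ₂ := ((GLn.placesSplitting n K S).symm γ).2)
        ((GLn.placesSplitting n K S).apply_symm_apply γ))
      (GLn.placesSplitting n K S).continuous (GLn.placesSplitting n K S).symm.continuous) ρq)
    -- Haar measures on the groups
    (νv : ∀ v : S, Measure (GL (Fin n) ((v : HeightOneSpectrum (𝓞 K)).adicCompletion K)))
    [∀ v, IsHaarMeasure (νv v)] [∀ v, (νv v).IsMulRightInvariant]
    (ν' : Measure (GLn.trivialAt n K S)) [IsHaarMeasure ν'] [ν'.IsMulRightInvariant]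
    (ν : Measure (AdelicGroupData.gl n K).Adelic) [IsHaarMeasure ν] [ν.IsMulRightInvariant]
    (hν : ν = Measure.map (GLn.placesSplitting n K S) ((Measure.pi νv).prod ν'))

include hCv hC' hρp hρ₁ hρq hρ hν in
/-- **Gelbart's (10.19) for `GL_n(𝔸_K)` with its equality sign, `[0, ∞]`-valued form.** With the
splitting `s = GLn.placesSplitting n K S : G_S × G^S ≃ₜ* GL_n(𝔸_K)`, `γ ∈ GL_n(𝔸_K)` with components
`γ_v` (`v ∈ S`), `γ^S = s_S(γ)`, closed tori `B_v = C(γ_v)`, `B^S = C(γ^S)`, Haar measures `ν_v`, `ν^S`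
on `G_v`, `G^S` and `ρ_v`, `ρ^S` on `B_v`, `B^S`, their products transported along `s` to `GL_n(𝔸_K)` and
to `B_𝔸 = C(γ) = s((Π_v B_v) × B^S)` (hypotheses `hρp`, `hρ₁`, `hρq`, `hρ`, `hν`; the Hausdorff instance on
`GL_n(𝔸_K)` is `t2Space_gl n K`), and measurable
`Φ, ξ_v, Θ ≥ 0` with `Φ(ι_S(a) k) = (Π_v ξ_v(a_v)) Θ(k)`:
`∫⁻_{G_𝔸/B_𝔸} Φ(y γ y⁻¹) d(ν/ρ) = (Π_{v ∈ S} ∫⁻_{G_v/B_v} ξ_v(a γ_v a⁻¹) d(ν_v/ρ_v)) ∫⁻_{G^S/B^S} Θ(k γ^S k⁻¹) d(ν^S/ρ^S)`.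
[cite: Gelbart1975, p. 155 (10.19)] -/
theorem GLn.lintegral_descConj_quotientMeasure_eq_prod_mul
    {Φ : (AdelicGroupData.gl n K).Adelic → ℝ≥0∞}
    {ξ : ∀ v : S, GL (Fin n) ((v : HeightOneSpectrum (𝓞 K)).adicCompletion K) → ℝ≥0∞}
    {Θ : GLn.trivialAt n K S → ℝ≥0∞} (hΦ : Measurable Φ) (hξ : ∀ v, Measurable (ξ v)) (hΘ : Measurable Θ)
    (hΦe : ∀ (a : GLn.LocalPi n K S) (k : GLn.trivialAt n K S),
      Φ (GLn.toAdelicPi n K S a * (k : (AdelicGroupData.gl n K).Adelic)) = (∏ v : S, ξ v (a v)) * Θ k) :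
    ∫⁻ y, descConj γ (Subgroup.centralizer ({γ} : Set (AdelicGroupData.gl n K).Adelic))
        (Literature.MeasureTheory.Group.centralizer_comm γ) Φ y
        ∂quotientMeasure (Subgroup.centralizer ({γ} : Set (AdelicGroupData.gl n K).Adelic)) ρ hC ν =
      (∏ v : S, ∫⁻ x, descConj (GLn.toLocalAt n K (v : HeightOneSpectrum (𝓞 K)) γ) _
          (Literature.MeasureTheory.Group.centralizer_comm _) (ξ v) x ∂quotientMeasure _ (ρv v) (hCv v) (νv v)) *
        ∫⁻ x, descConj ((GLn.placesSplitting n K S).symm γ).2 _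
          (Literature.MeasureTheory.Group.centralizer_comm _) Θ x ∂quotientMeasure _ ρ' hC' ν' := by
  haveI : ∀ v : HeightOneSpectrum (𝓞 K), T2Space (GL (Fin n) (v.adicCompletion K)) := fun v => GLn.t2Space_local v
  haveI : SecondCountableTopology (GLn.trivialAt n K S) := TopologicalSpace.Subtype.secondCountableTopology _
  have hγ : (GLn.placesSplitting n K S).toMulEquiv
      ((fun v : S => GLn.toLocalAt n K (v : HeightOneSpectrum (𝓞 K)) γ), ((GLn.placesSplitting n K S).symm γ).2) = γ :=
    (GLn.placesSplitting n K S).apply_symm_apply γ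
  exact Literature.MeasureTheory.Group.lintegral_descConj_quotientMeasure_eq_prod_mul
    (GLn.placesSplitting n K S).toMulEquiv (GLn.placesSplitting n K S).continuous (GLn.placesSplitting n K S).symm.continuous
    hγ hC hCv hC' ρv ρ' ρp hρp ρ₁ hρ₁ ρq hρq ρ hρ νv ν' ν hν hΦ hξ hΘ hΦe

include hCv hC' hρp hρ₁ hρq hρ hν in
/-- **Gelbart's (10.19) for `GL_n(𝔸_K)` with its equality sign, complex-valued form** (same data; all
complex `Φ, ξ_v, Θ` with `Φ(ι_S(a) k) = (Π_v ξ_v(a_v)) Θ(k)`). [cite: Gelbart1975, p. 155 (10.19)] -/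
theorem GLn.integral_descConj_quotientMeasure_eq_prod_mul
    (Φ : (AdelicGroupData.gl n K).Adelic → ℂ) (ξ : ∀ v : S, GL (Fin n) ((v : HeightOneSpectrum (𝓞 K)).adicCompletion K) → ℂ)
    (Θ : GLn.trivialAt n K S → ℂ)
    (hΦe : ∀ (a : GLn.LocalPi n K S) (k : GLn.trivialAt n K S),
      Φ (GLn.toAdelicPi n K S a * (k : (AdelicGroupData.gl n K).Adelic)) = (∏ v : S, ξ v (a v)) * Θ k) :
    ∫ y, descConj γ (Subgroup.centralizer ({γ} : Set (AdelicGroupData.gl n K).Adelic))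
        (Literature.MeasureTheory.Group.centralizer_comm γ) Φ y
        ∂quotientMeasure (Subgroup.centralizer ({γ} : Set (AdelicGroupData.gl n K).Adelic)) ρ hC ν =
      (∏ v : S, ∫ x, descConj (GLn.toLocalAt n K (v : HeightOneSpectrum (𝓞 K)) γ) _
          (Literature.MeasureTheory.Group.centralizer_comm _) (ξ v) x ∂quotientMeasure _ (ρv v) (hCv v) (νv v)) *
        ∫ x, descConj ((GLn.placesSplitting n K S).symm γ).2 _
          (Literature.MeasureTheory.Group.centralizer_comm _) Θ x ∂quotientMeasure _ ρ' hC' ν' := by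
  haveI : ∀ v : HeightOneSpectrum (𝓞 K), T2Space (GL (Fin n) (v.adicCompletion K)) := fun v => GLn.t2Space_local v
  haveI : SecondCountableTopology (GLn.trivialAt n K S) := TopologicalSpace.Subtype.secondCountableTopology _
  have hγ : (GLn.placesSplitting n K S).toMulEquiv
      ((fun v : S => GLn.toLocalAt n K (v : HeightOneSpectrum (𝓞 K)) γ), ((GLn.placesSplitting n K S).symm γ).2) = γ :=
    (GLn.placesSplitting n K S).apply_symm_apply γ
  exact Literature.MeasureTheory.Group.integral_descConj_quotientMeasure_eq_prod_mul
    (GLn.placesSplitting n K S).toMulEquiv (GLn.placesSplitting n K S).continuous (GLn.placesSplitting n K S).symm.continuous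
    hγ hC hCv hC' ρv ρ' ρp hρp ρ₁ hρ₁ ρq hρq ρ hρ νv ν' ν hν Φ ξ Θ hΦe

end OrbitalNormalized

end Literature.NumberTheory.Automorphic
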